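import Summits.QuantumFields.YangMills.Theorems.BalabanUVNodesPortS1LocPowSeries

/-!
# NODE O port PT-A — `stub_G3C` helper (repaired road, leaf (γ)): THE `O(1/M)` COMMUTATOR — `‖[T, h]‖ ≤ c/(δ₁·M)` for a kernel with `e^{δ₁d}`-weighted Schur sums `≤ c` and a
# multiplication operator `h` that is `1/M`-Lipschitz in the site pseudo-distance `d`; the commutator keeps HALF the lattice rate (weighted Schur at `δ₁/2` with constant `2c/(δ₁M)`)

Cell `ym-nodeO-ideate`, porter hand `hand-27930-G3C` (g0); proof kind, `--supports stmt-QuantumFields-27930 --as helper` (count-neutral).  [B9] = [Balaban1985BackgroundPropagators],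
[16] = [Balaban1985UV3].

WHY.  Print's per-step small factor of the generalized random walk expansion ([16] (23) p.262 `O(M^{−1/2})^{|ω|}`; [B9] (3.89) p.409 `K(h_□)G′_□h_□`) comes from the SEMI-LOCAL operator
`K(h_□) = [Δ′, h_□]` with a partition of unity `h_□` varying on the scale `M` of the big cubes: an operator whose kernel has `e^{δ₁·d}`-weighted Schur sums `≤ c` (the hand's (P4-lat)
`P0CarrierLatticeDecay`, see `G3C-OBSTRUCTION-v1.md` §4) has `‖[T, h]‖ ≤ c/(δ₁M)` whenever `|h(i) − h(j)| ≤ d(i,j)/M` — THIS is the lever by which «κ can be arbitrarily large if M₁ is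
sufficiently large» ([16] p.262), and exactly what the cube-scale body `P0CarrierClauses` cannot give (`|h(i) − h(j)| ≤ 1` only ⟹ `‖[T,h]‖ ≤ c₀`).  With ✓`…G3CCombesThomas` (p821411) it is
the second generic brick of leaf (γ) of the repaired stub `G3CAtRecordL`.

WHAT THIS FILE PROVES (sorry-free, generic over a finite index type, `d ≥ 0`):
* `le_two_div_mul_exp_half` — `t ≤ (2/δ)·e^{(δ/2)t}` (`t ≥ 0`, `δ > 0`); `le_inv_mul_exp` — `t ≤ δ⁻¹·e^{δt}`.
* `commDiag_apply` — `(T * diagonal h − diagonal h * T) i j = T i j * (h j − h i)`.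
* `rowSum_commDiag_le` ∕ `colSum_commDiag_le` — plain Schur sums of the commutator `≤ c/(δ₁M)`; ★ `l2_opNorm_commDiag_le` — `‖[T, h]‖ ≤ c/(δ₁M)` (✓`l2_opNorm_le_of_row_col_sum`).
* `weightedRowSum_commDiag_le` ∕ `weightedColSum_commDiag_le` — the commutator's `e^{(δ₁/2)d}`-weighted Schur sums are `≤ 2c/(δ₁M)` (it stays lattice-localized at half the rate, so
  Combes–Thomas keeps running on products `[T,h]·G_□·h`).

HONEST FRAMING.  Elementary; nothing of Bałaban's asserted, ported or discharged; `stub_G3C` NOT closed (mis-cut verdict stands; this serves the REPAIRED letter); 27930 OPEN; NODE O 0∕1;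
COUNT 8∕28 · K 1∕4 UNMOVED; finite `𝕋⁴` at fixed ε — NOT continuum ∕ OS ∕ Clay; **the Yang–Mills mass gap is NOT proved by any of this.**  No `sorry`, no `instance`, no `notation`, no `def`;
standard axioms.
-/

noncomputable section

open scoped BigOperators Matrix.Norms.L2Operator
open Finset

namespace Summit.QuantumFields.YangMills.Theorems.BalabanUVNodesPortS1.G3CCT

variable {ι : Type*} [Fintype ι] [DecidableEq ι]

omit [Fintype ι] [DecidableEq ι] in
/-- `t ≤ (2/δ)·e^{(δ/2)·t}` for `δ > 0` (from `x + 1 ≤ e^x`). [folklore] -/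
theorem le_two_div_mul_exp_half {δ t : ℝ} (hδ : 0 < δ) : t ≤ 2 / δ * Real.exp (δ / 2 * t) := by
  have h := Real.add_one_le_exp (δ / 2 * t)
  rw [div_mul_eq_mul_div, le_div_iff₀ hδ]
  nlinarith [Real.exp_pos (δ / 2 * t)]

omit [Fintype ι] [DecidableEq ι] in
/-- `t ≤ δ⁻¹·e^{δt}` for `δ > 0`. [folklore] -/
theorem le_inv_mul_exp {δ t : ℝ} (hδ : 0 < δ) : t ≤ δ⁻¹ * Real.exp (δ * t) := by
  have h := Real.add_one_le_exp (δ * t)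
  rw [le_inv_mul_iff₀ hδ]
  linarith

omit [Fintype ι] in
/-- Entries of the commutator with a multiplication operator: `(T·h − h·T) i j = T i j · (h j − h i)`. [folklore] -/
theorem commDiag_apply [Fintype ι] (T : Matrix ι ι ℂ) (h : ι → ℝ) (i j : ι) :
    (T * Matrix.diagonal (fun k => (h k : ℂ)) - Matrix.diagonal (fun k => (h k : ℂ)) * T) i j = T i j * ((h j : ℂ) - h i) := by
  rw [Matrix.sub_apply, Matrix.mul_diagonal, Matrix.diagonal_mul]
  ring

omit [Fintype ι] in
/-- Norm of a commutator entry under the Lipschitz hypothesis: `‖[T,h] i j‖ ≤ ‖T i j‖·d(i,j)/M`. [folklore] -/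
theorem norm_commDiag_apply_le [Fintype ι] (T : Matrix ι ι ℂ) {h : ι → ℝ} {d : ι → ι → ℝ} {M : ℝ}
    (hLip : ∀ i j, |h i - h j| ≤ d i j / M) (i j : ι) :
    ‖(T * Matrix.diagonal (fun k => (h k : ℂ)) - Matrix.diagonal (fun k => (h k : ℂ)) * T) i j‖ ≤ ‖T i j‖ * (d i j / M) := by
  rw [commDiag_apply, norm_mul]
  refine mul_le_mul_of_nonneg_left ?_ (norm_nonneg _)
  rw [← Complex.ofReal_sub, Complex.norm_real, Real.norm_eq_abs, abs_sub_comm]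
  exact hLip i j

/-- **Plain Schur ROW sum of the commutator**: `Σ_j ‖[T,h] i j‖ ≤ c/(δ₁M)`. [folklore] -/
theorem rowSum_commDiag_le (T : Matrix ι ι ℂ) {h : ι → ℝ} {d : ι → ι → ℝ} {M c δ₁ : ℝ} (hM : 0 < M) (hδ₁ : 0 < δ₁)
    (hLip : ∀ i j, |h i - h j| ≤ d i j / M) (hrow : ∀ i, ∑ j, ‖T i j‖ * Real.exp (δ₁ * d i j) ≤ c) (i : ι) :
    ∑ j, ‖(T * Matrix.diagonal (fun k => (h k : ℂ)) - Matrix.diagonal (fun k => (h k : ℂ)) * T) i j‖ ≤ c / (δ₁ * M) := by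
  calc ∑ j, ‖(T * Matrix.diagonal (fun k => (h k : ℂ)) - Matrix.diagonal (fun k => (h k : ℂ)) * T) i j‖
      ≤ ∑ j, ‖T i j‖ * (δ₁⁻¹ * Real.exp (δ₁ * d i j)) / M := by
        refine Finset.sum_le_sum fun j _ => (norm_commDiag_apply_le T hLip i j).trans ?_
        rw [mul_div_assoc]
        exact mul_le_mul_of_nonneg_left (div_le_div_of_nonneg_right (le_inv_mul_exp hδ₁) hM.le) (norm_nonneg _)
    _ = (δ₁ * M)⁻¹ * ∑ j, ‖T i j‖ * Real.exp (δ₁ * d i j) := by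
        rw [Finset.mul_sum]; refine Finset.sum_congr rfl fun j _ => ?_; field_simp
    _ ≤ (δ₁ * M)⁻¹ * c := mul_le_mul_of_nonneg_left (hrow i) (by positivity)
    _ = c / (δ₁ * M) := by rw [inv_mul_eq_div]

/-- **Plain Schur COLUMN sum of the commutator**: `Σ_i ‖[T,h] i j‖ ≤ c/(δ₁M)`. [folklore] -/
theorem colSum_commDiag_le (T : Matrix ι ι ℂ) {h : ι → ℝ} {d : ι → ι → ℝ} {M c δ₁ : ℝ} (hM : 0 < M) (hδ₁ : 0 < δ₁)
    (hLip : ∀ i j, |h i - h j| ≤ d i j / M) (hcol : ∀ j, ∑ i, ‖T i j‖ * Real.exp (δ₁ * d i j) ≤ c) (j : ι) :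
    ∑ i, ‖(T * Matrix.diagonal (fun k => (h k : ℂ)) - Matrix.diagonal (fun k => (h k : ℂ)) * T) i j‖ ≤ c / (δ₁ * M) := by
  calc ∑ i, ‖(T * Matrix.diagonal (fun k => (h k : ℂ)) - Matrix.diagonal (fun k => (h k : ℂ)) * T) i j‖
      ≤ ∑ i, ‖T i j‖ * (δ₁⁻¹ * Real.exp (δ₁ * d i j)) / M := by
        refine Finset.sum_le_sum fun i _ => (norm_commDiag_apply_le T hLip i j).trans ?_
        rw [mul_div_assoc]
        exact mul_le_mul_of_nonneg_left (div_le_div_of_nonneg_right (le_inv_mul_exp hδ₁) hM.le) (norm_nonneg _)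
    _ = (δ₁ * M)⁻¹ * ∑ i, ‖T i j‖ * Real.exp (δ₁ * d i j) := by
        rw [Finset.mul_sum]; refine Finset.sum_congr rfl fun i _ => ?_; field_simp
    _ ≤ (δ₁ * M)⁻¹ * c := mul_le_mul_of_nonneg_left (hcol j) (by positivity)
    _ = c / (δ₁ * M) := by rw [inv_mul_eq_div]

/-- ★ **THE `O(1/M)` COMMUTATOR**: `‖T·h − h·T‖ ≤ c/(δ₁M)` in the `ℓ²`-operator norm ([B9] (3.89)'s small factor, abstractly). [cite: Balaban1985BackgroundPropagators, (3.89) p.409; Balaban1985UV3, (23) p.262] -/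
theorem l2_opNorm_commDiag_le (T : Matrix ι ι ℂ) {h : ι → ℝ} {d : ι → ι → ℝ} {M c δ₁ : ℝ} (hM : 0 < M) (hδ₁ : 0 < δ₁) (hc : 0 ≤ c)
    (hLip : ∀ i j, |h i - h j| ≤ d i j / M) (hrow : ∀ i, ∑ j, ‖T i j‖ * Real.exp (δ₁ * d i j) ≤ c)
    (hcol : ∀ j, ∑ i, ‖T i j‖ * Real.exp (δ₁ * d i j) ≤ c) :
    ‖T * Matrix.diagonal (fun k => (h k : ℂ)) - Matrix.diagonal (fun k => (h k : ℂ)) * T‖ ≤ c / (δ₁ * M) :=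
  l2_opNorm_le_of_row_col_sum _ (by positivity) (rowSum_commDiag_le T hM hδ₁ hLip hrow) (colSum_commDiag_le T hM hδ₁ hLip hcol)

/-- **The commutator stays lattice-localized at half the rate (rows)**: `Σ_j ‖[T,h] i j‖·e^{(δ₁/2)d(i,j)} ≤ 2c/(δ₁M)` (needs `d ≥ 0`). [folklore] -/
theorem weightedRowSum_commDiag_le (T : Matrix ι ι ℂ) {h : ι → ℝ} {d : ι → ι → ℝ} {M c δ₁ : ℝ} (hM : 0 < M) (hδ₁ : 0 < δ₁)
    (hLip : ∀ i j, |h i - h j| ≤ d i j / M)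
    (hrow : ∀ i, ∑ j, ‖T i j‖ * Real.exp (δ₁ * d i j) ≤ c) (i : ι) :
    ∑ j, ‖(T * Matrix.diagonal (fun k => (h k : ℂ)) - Matrix.diagonal (fun k => (h k : ℂ)) * T) i j‖ * Real.exp (δ₁ / 2 * d i j) ≤
      2 * c / (δ₁ * M) := by
  have hkey : ∀ j, ‖(T * Matrix.diagonal (fun k => (h k : ℂ)) - Matrix.diagonal (fun k => (h k : ℂ)) * T) i j‖ * Real.exp (δ₁ / 2 * d i j)
      ≤ 2 / (δ₁ * M) * (‖T i j‖ * Real.exp (δ₁ * d i j)) := by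
    intro j
    have h1 := norm_commDiag_apply_le T hLip i j
    have h2 : d i j ≤ 2 / δ₁ * Real.exp (δ₁ / 2 * d i j) := le_two_div_mul_exp_half hδ₁
    have hsq : Real.exp (δ₁ / 2 * d i j) * Real.exp (δ₁ / 2 * d i j) = Real.exp (δ₁ * d i j) := by rw [← Real.exp_add]; ring_nf
    calc ‖(T * Matrix.diagonal (fun k => (h k : ℂ)) - Matrix.diagonal (fun k => (h k : ℂ)) * T) i j‖ * Real.exp (δ₁ / 2 * d i j)
        ≤ ‖T i j‖ * (d i j / M) * Real.exp (δ₁ / 2 * d i j) := mul_le_mul_of_nonneg_right h1 (Real.exp_pos _).le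
      _ ≤ ‖T i j‖ * (2 / δ₁ * Real.exp (δ₁ / 2 * d i j) / M) * Real.exp (δ₁ / 2 * d i j) := by
          refine mul_le_mul_of_nonneg_right (mul_le_mul_of_nonneg_left ?_ (norm_nonneg _)) (Real.exp_pos _).le
          exact div_le_div_of_nonneg_right h2 hM.le
      _ = 2 / (δ₁ * M) * (‖T i j‖ * Real.exp (δ₁ * d i j)) := by rw [← hsq]; field_simp
  calc ∑ j, ‖(T * Matrix.diagonal (fun k => (h k : ℂ)) - Matrix.diagonal (fun k => (h k : ℂ)) * T) i j‖ * Real.exp (δ₁ / 2 * d i j)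
      ≤ ∑ j, 2 / (δ₁ * M) * (‖T i j‖ * Real.exp (δ₁ * d i j)) := Finset.sum_le_sum fun j _ => hkey j
    _ = 2 / (δ₁ * M) * ∑ j, ‖T i j‖ * Real.exp (δ₁ * d i j) := by rw [Finset.mul_sum]
    _ ≤ 2 / (δ₁ * M) * c := mul_le_mul_of_nonneg_left (hrow i) (by positivity)
    _ = 2 * c / (δ₁ * M) := by ring

/-- **The commutator stays lattice-localized at half the rate (columns)**: `Σ_i ‖[T,h] i j‖·e^{(δ₁/2)d(i,j)} ≤ 2c/(δ₁M)`. [folklore] -/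
theorem weightedColSum_commDiag_le (T : Matrix ι ι ℂ) {h : ι → ℝ} {d : ι → ι → ℝ} {M c δ₁ : ℝ} (hM : 0 < M) (hδ₁ : 0 < δ₁)
    (hLip : ∀ i j, |h i - h j| ≤ d i j / M)
    (hcol : ∀ j, ∑ i, ‖T i j‖ * Real.exp (δ₁ * d i j) ≤ c) (j : ι) :
    ∑ i, ‖(T * Matrix.diagonal (fun k => (h k : ℂ)) - Matrix.diagonal (fun k => (h k : ℂ)) * T) i j‖ * Real.exp (δ₁ / 2 * d i j) ≤
      2 * c / (δ₁ * M) := by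
  have hkey : ∀ i, ‖(T * Matrix.diagonal (fun k => (h k : ℂ)) - Matrix.diagonal (fun k => (h k : ℂ)) * T) i j‖ * Real.exp (δ₁ / 2 * d i j)
      ≤ 2 / (δ₁ * M) * (‖T i j‖ * Real.exp (δ₁ * d i j)) := by
    intro i
    have h1 := norm_commDiag_apply_le T hLip i j
    have h2 : d i j ≤ 2 / δ₁ * Real.exp (δ₁ / 2 * d i j) := le_two_div_mul_exp_half hδ₁
    have hsq : Real.exp (δ₁ / 2 * d i j) * Real.exp (δ₁ / 2 * d i j) = Real.exp (δ₁ * d i j) := by rw [← Real.exp_add]; ring_nf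
    calc ‖(T * Matrix.diagonal (fun k => (h k : ℂ)) - Matrix.diagonal (fun k => (h k : ℂ)) * T) i j‖ * Real.exp (δ₁ / 2 * d i j)
        ≤ ‖T i j‖ * (d i j / M) * Real.exp (δ₁ / 2 * d i j) := mul_le_mul_of_nonneg_right h1 (Real.exp_pos _).le
      _ ≤ ‖T i j‖ * (2 / δ₁ * Real.exp (δ₁ / 2 * d i j) / M) * Real.exp (δ₁ / 2 * d i j) := by
          refine mul_le_mul_of_nonneg_right (mul_le_mul_of_nonneg_left ?_ (norm_nonneg _)) (Real.exp_pos _).le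
          exact div_le_div_of_nonneg_right h2 hM.le
      _ = 2 / (δ₁ * M) * (‖T i j‖ * Real.exp (δ₁ * d i j)) := by rw [← hsq]; field_simp
  calc ∑ i, ‖(T * Matrix.diagonal (fun k => (h k : ℂ)) - Matrix.diagonal (fun k => (h k : ℂ)) * T) i j‖ * Real.exp (δ₁ / 2 * d i j)
      ≤ ∑ i, 2 / (δ₁ * M) * (‖T i j‖ * Real.exp (δ₁ * d i j)) := Finset.sum_le_sum fun i _ => hkey i
    _ = 2 / (δ₁ * M) * ∑ i, ‖T i j‖ * Real.exp (δ₁ * d i j) := by rw [Finset.mul_sum]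
    _ ≤ 2 / (δ₁ * M) * c := mul_le_mul_of_nonneg_left (hcol j) (by positivity)
    _ = 2 * c / (δ₁ * M) := by ring

end Summit.QuantumFields.YangMills.Theorems.BalabanUVNodesPortS1.G3CCT

end
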